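/-
Copyright (c) 2026 the pub-hodgecm-mathlib formalisation cell (harness21).  Prover seat hodgecm-mathlib-K2Liu-p13 (g4), Track B «K2-LIT»,
#184♮ = hLiu418 = `stmt-HodgeConjecture-24832`; ROAD Φ (RULING «M-156n»), #41 TOP edition 5 «ASSEMBLED» (★ `siegelEisensteinContinuation_assembled`, K2E5-p17 (g8))
— the KIND-0 big-cell CONTINUATION LETTER `(E, hEd, hEeq)` REDUCED: from «every `h ∈ H(𝔸)`» to «every `k ∈ K`», to «FINITELY MANY `κ_l ∈ K`», and to «`h = 1` for every
standard family» (LEAD F0P6-plan (g14) BATCH #50 (6): «successor (g4) on UP: Φ8 remaining = `(E,hEd,hEeq)` continuation triple consumer side»).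
THEOREMS ONLY (no `def`, no `instance`, no named-fact hypothesis, no `sorry`).
-/
import Summits.HodgeConjecture.HodgeConjecture.Theorems.K2LiuIntertwiningDeltaReflect      -- ★ `intertwiningDelta_siegel_mul_reflect` (`M(s) : I(s,χ) → I(−s,χʷ)`), ★ translate repr
import Summits.HodgeConjecture.HodgeConjecture.Theorems.K2LiuRankOneCentreContinuation     -- ★ `differentiable_siegelDeltaCharacter_comp`
import HarnessLib

/-!
# Crux `HLiu418`, ROAD Φ, organ Φ8 (row G6): THE BIG-CELL CONTINUATION LETTER `(E, hEd, hEeq)` OF THE #41 TOP, REDUCED TO POINTS OF `K` AND TO `h = 1`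

Cell `hodgecm-mathlib`, crux item hLiu418 = `stmt-HodgeConjecture-24832` (helper lane, count-neutral).  GENERIC `n`, doubled frame `H(𝔸) = HA L e dV hdV dW hdW`,
Iwasawa datum `𝒦` (★ `IwasawaDatum`: `H(𝔸) = P_Δ(𝔸)·K`), Haar measure `νN` on `N_Δ(𝔸)`, big cell `M(s)f_s = intertwiningDelta νN (f s)`.
The #41 TOP (★ edition 5 `K2LiuSiegelEisensteinContinuationTopAssembled.siegelEisensteinContinuation_assembled`, also ★ `exists_E₈`, ★ `exists_bigCell_termPackage_cm`)
takes BY VALUE the continuation letter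
`(E : ℂ → H(𝔸) → ℂ) (hEd : ∀ x, DifferentiableOn ℂ (E · x) {0 < re}) (hEeq : ∀ s x, n∕2 < re s → E s x = a s * intertwiningDelta νN (f s) x)`.
THIS FILE proves that the letter for ALL `x ∈ H(𝔸)` follows from much less, with NO analysis beyond what is ★:
* §1 right translates: `M(s)(R_k φ)(x) = M(s)φ(x k)` (`intertwiningDelta_rightTranslate`); `K`-finiteness and standardness are stable under `R_k`, `k ∈ K`.
* §2 **`exists_continuation_of_pointwise_K`** — if for every `k ∈ K` the SCALAR function `s ↦ a(s)·M(s)f_s(k)` continues holomorphically to `{0 < re}`, then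
  `(E, hEd, hEeq)` holds for every `x ∈ H(𝔸)`: write `x = p k` (Iwasawa, a CHOICE — no well-definedness is needed) and put `E s x := χʷ_{−s}(p) · E_k(s)`;
  `hEd` by ★ `differentiable_siegelDeltaCharacter_comp`, `hEeq` by the section law of the big cell ★ `intertwiningDelta_siegel_mul_reflect` (`χʷ := reflectChar c χ`).
  Only `f_s ∈ I(s, χ)` is used (no `K`-finiteness, no continuity, no unitarity).
* §3 **`exists_finset_reduction`** — for a FLAT, `K`-FINITE family with continuous members and unitary `χ` there are finitely many `κ_l ∈ K` such that the
  continuation of the finitely many scalar functions `s ↦ a(s)·M(s)f_s(κ_l)` gives `(E, hEd, hEeq)`: ★ `exists_translate_repr` ∕ ★ `translate_repr_family` ∕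
  ★ `intertwiningDelta_translate_repr` (`M(s)f_s(k) = Σ_l d_l(k)·M(s)f_s(κ_l)` on `re s > n∕2`) feed §2 with `E_k := Σ_l d_l(k)·E_{κ_l}`.
* §4 the socket's binders: **`exists_continuation_of_isStandardSectionFamily_finset`** (from `hstd`, `hcont`, `hχ`) and **`exists_continuation_of_atOne`** — if
  `s ↦ a(s)·M(s)g_s(1)` continues for EVERY standard family `g` (the Euler-product point: at `h = 1` every local component is in `K_v`), then `(E, hEd, hEeq)` for every
  standard `f` (apply it to the standard families `R_k f`, `k ∈ K`).
So the #41 TOP's kind-0 continuation letter is now a statement about finitely many scalar functions `s ↦ a(s)·∫_{N_Δ(𝔸)} f_s(w_Δ u κ_l) du` — the currency of the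
factorisation (★ Φ3c∕Φ3d `whittakerDelta_eq_mul_tprod` at index `0`), of Gindikin–Karpelevich off `S`, of the bad-place local operators and of the archimedean ladder (σ20).
Sources: [Garrett2018, §3.10–§3.12]; [MoeglinWaldspurger1995, II.1.6–II.1.7, IV.1.8]; [HarrisKudlaSweet1996, (1.15)–(1.17), §6]; [KudlaSweet1997, §1]; [Tan1999, §1–§3];
[BorelJacquet1979, §1.2].
HONEST LABEL.  Helper lemmas, count-neutral; `HC_CM` is proved only modulo the 7 printed citations (2 remaining named inputs:
hLiu418 = `stmt-HodgeConjecture-24832`, h413 = `stmt-HodgeConjecture-24833`) until rung 0 closes.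
-/

set_option autoImplicit false
set_option linter.dupNamespace false -- the mandated namespace repeats `HodgeConjecture.HodgeConjecture`

noncomputable section

open scoped Matrix NNReal ENNReal
open NumberField IsDedekindDomain MeasureTheory MeasureTheory.Measure Metric

namespace Summit.HodgeConjecture.HodgeConjecture.Cruxes.HLiu418.K2LiuBigCellContinuationReduction

open Literature.NumberTheory.GelbartRogawski1991.AdaptedBlocks
open Literature.NumberTheory.Automorphic Literature.NumberTheory.Automorphic.UnitaryGroup
open Literature.NumberTheory.GelbartRogawski1991 Literature.NumberTheory.GelbartRogawski1991.GRConstruction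
open Literature.NumberTheory.K2Lit.SiegelDoubled Literature.NumberTheory.GaloisRepresentations
open UnitaryDualPair
open Summit.HodgeConjecture.HodgeConjecture.Cruxes.HLiu418.K2LiuIntertwiningDeltaReflect (intertwiningDelta_siegel_mul_reflect)
open Summit.HodgeConjecture.HodgeConjecture.Cruxes.HLiu418.K2LiuBigCellGrowthOfStandard
  (exists_translate_repr translate_repr_family intertwiningDelta_translate_repr)
open Summit.HodgeConjecture.HodgeConjecture.Cruxes.HLiu418.K2LiuRankOneCentreContinuation (differentiable_siegelDeltaCharacter_comp)
open Summit.HodgeConjecture.HodgeConjecture.Cruxes.H413.K2E1CharacterEisensteinU2Defs (reflectChar)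

variable (L : Type) [Field L] [NumberField L] [IsCMField L]
variable {N M n : ℕ} (e : Fin N × Fin M ≃ Fin n)
  (dV : Fin N → L) (hdV : ∀ i, IsCMField.complexConj L (dV i) = dV i)
  (dW : Fin M → L) (hdW : ∀ i, IsCMField.complexConj L (dW i) = dW i)

/-! ## §1 Right translates -/

/-- **`M(s)(R_k φ)(x) = M(s)φ(x k)`**: the Siegel intertwining integral commutes with right translation (it integrates on the LEFT of the argument).
[cite: MoeglinWaldspurger1995, II.1.6] [cite: Garrett2018, §3.10] -/
theorem intertwiningDelta_rightTranslate [MeasurableSpace (unipDelta L e dV hdV dW hdW)] (νN : Measure (unipDelta L e dV hdV dW hdW))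
    (φ : HA L e dV hdV dW hdW → ℂ) (k x : HA L e dV hdV dW hdW) :
    intertwiningDelta L e dV hdV dW hdW νN (fun y => φ (y * k)) x = intertwiningDelta L e dV hdV dW hdW νN φ (x * k) := by
  unfold intertwiningDelta
  simp_rw [mul_assoc]

/-- at `x = 1`: `M(s)(R_k φ)(1) = M(s)φ(k)`. [cite: MoeglinWaldspurger1995, II.1.6] -/
theorem intertwiningDelta_rightTranslate_one [MeasurableSpace (unipDelta L e dV hdV dW hdW)] (νN : Measure (unipDelta L e dV hdV dW hdW))
    (φ : HA L e dV hdV dW hdW → ℂ) (k : HA L e dV hdV dW hdW) :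
    intertwiningDelta L e dV hdV dW hdW νN (fun y => φ (y * k)) 1 = intertwiningDelta L e dV hdV dW hdW νN φ k := by
  rw [intertwiningDelta_rightTranslate, one_mul]

variable {L e dV hdV dW hdW} in
/-- `K`-finiteness is stable under right translation by `k ∈ K` (the translates of `R_k φ` are translates of `φ`). [cite: Tan1999, §1] [cite: BorelJacquet1979, §1.2] -/
theorem isKFinite_rightTranslate {𝒦 : IwasawaDatum L e dV hdV dW hdW} {φ : HA L e dV hdV dW hdW → ℂ} (hφ : IsKFinite 𝒦 φ)
    {k : HA L e dV hdV dW hdW} (hk : k ∈ 𝒦.K) : IsKFinite 𝒦 (fun y => φ (y * k)) := by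
  unfold Literature.NumberTheory.K2Lit.SiegelDoubled.IsKFinite at *
  haveI := hφ
  refine Submodule.finiteDimensional_of_le (S₁ := rightTranslateSpan 𝒦 (fun y => φ (y * k))) (S₂ := rightTranslateSpan 𝒦 φ)
    (Submodule.span_le.2 ?_)
  rintro _ ⟨k', rfl⟩
  have h := rightTranslate_mem_rightTranslateSpan 𝒦 φ (𝒦.K.mul_mem k'.2 hk)
  simp only [← mul_assoc] at h
  exact h

variable {L e dV hdV dW hdW} in
/-- **standard families are stable under right translation by `k ∈ K`**: `(s, y) ↦ f_s(y k)` is again holomorphic, `K`-finite and flat on `K`.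
[cite: Tan1999, §1] [cite: HarrisKudlaSweet1996, (1.17)] -/
theorem isStandardSectionFamily_rightTranslate {𝒦 : IwasawaDatum L e dV hdV dW hdW} {χ : HeckeCharacter L} {f : ℂ → HA L e dV hdV dW hdW → ℂ}
    (hf : IsStandardSectionFamily 𝒦 χ f) {k : HA L e dV hdV dW hdW} (hk : k ∈ 𝒦.K) :
    IsStandardSectionFamily 𝒦 χ (fun s y => f s (y * k)) :=
  ⟨hf.1.rightTranslate k, fun s => isKFinite_rightTranslate (hf.2.1 s) hk, fun k' hk' s s' => hf.2.2 (k' * k) (𝒦.K.mul_mem hk' hk) s s'⟩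

/-! ## §2 From the points of `K` to all of `H(𝔸)`: Iwasawa + the section law of the big cell -/

/-- **THE CONTINUATION LETTER FROM THE POINTS OF `K`.**  Let `f_s ∈ I(s, χ)` for every `s`, `a` any scalar, `c` any abscissa.  If for every `k ∈ K` there is `E_k`
holomorphic on `{0 < re}` with `E_k(s) = a(s)·M(s)f_s(k)` for `c < re s`, then there is `E : ℂ → H(𝔸) → ℂ`, holomorphic on `{0 < re}` in `s` for every `x`, with
`E s x = a(s)·M(s)f_s(x)` for `c < re s` and ALL `x`: `x = p·k` (Iwasawa, any choice), `E s x := χʷ_{−s}(p)·E_k(s)`, and `M(s)f_s(p k) = χʷ_{−s}(p)·M(s)f_s(k)`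
(★ `intertwiningDelta_siegel_mul_reflect`). [cite: Garrett2018, §3.10–§3.12] [cite: MoeglinWaldspurger1995, II.1.7, IV.1.8] [cite: KudlaSweet1997, §1] -/
theorem exists_continuation_of_pointwise_K (hdV0 : ∀ i, dV i ≠ 0) (hdW0 : ∀ i, dW i ≠ 0) (𝒦 : IwasawaDatum L e dV hdV dW hdW)
    [MeasurableSpace (unipDelta L e dV hdV dW hdW)] [BorelSpace (unipDelta L e dV hdV dW hdW)]
    (νN : Measure (unipDelta L e dV hdV dW hdW)) [νN.IsHaarMeasure] (χ : HeckeCharacter L) (c : ℝ)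
    (f : ℂ → HA L e dV hdV dW hdW → ℂ) (hf : ∀ s : ℂ, IsSiegelDeltaSection L e dV hdV dW hdW χ s (f s)) (a : ℂ → ℂ)
    (hK : ∀ k ∈ (𝒦.K : Set (HA L e dV hdV dW hdW)), ∃ Ek : ℂ → ℂ, DifferentiableOn ℂ Ek {s : ℂ | 0 < s.re} ∧
      ∀ s : ℂ, c < s.re → Ek s = a s * intertwiningDelta L e dV hdV dW hdW νN (f s) k) :
    ∃ E : ℂ → HA L e dV hdV dW hdW → ℂ,
      (∀ x : HA L e dV hdV dW hdW, DifferentiableOn ℂ (fun s : ℂ => E s x) {s : ℂ | 0 < s.re}) ∧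
      (∀ (s : ℂ) (x : HA L e dV hdV dW hdW), c < s.re → E s x = a s * intertwiningDelta L e dV hdV dW hdW νN (f s) x) := by
  choose p k hp hk hpk using 𝒦.iwasawa
  choose Ek hEkd hEkeq using hK
  refine ⟨fun s x => siegelDeltaCharacter L e dV hdV dW hdW (reflectChar (IsCMField.complexConj L : L ≃ₐ[Fp L] L) χ) (-s) (p x) * Ek (k x) (hk x) s,
    fun x => ?_, fun s x hs => ?_⟩
  · exact ((differentiable_siegelDeltaCharacter_comp L e dV hdV dW hdW _ (p x) differentiable_neg).differentiableOn).mul (hEkd _ _)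
  · have hsec := intertwiningDelta_siegel_mul_reflect L e dV hdV dW hdW hdV0 hdW0 νN χ s (hf s) (hp x) (k x)
    rw [← hpk x] at hsec
    simp only
    rw [hEkeq _ _ s hs, hsec]
    ring

/-! ## §3 From finitely many points of `K`: `K`-finiteness -/

/-- **THE CONTINUATION LETTER FROM FINITELY MANY POINTS OF `K`.**  Let `f_s ∈ I(s, χ)` (`χ` unitary) be flat on `K` with `f_{s₀}` `K`-finite and every `f_s` continuous.
There is a finite set `T ⊂ K` such that: whenever the finitely many scalar functions `s ↦ a(s)·M(s)f_s(κ)`, `κ ∈ T`, continue holomorphically from `re s > n∕2` to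
`{0 < re}`, the whole letter `(E, hEd, hEeq)` holds (`M(s)f_s(k) = Σ_{κ∈T} d_κ(k)·M(s)f_s(κ)` ★ `intertwiningDelta_translate_repr`, then §2).
[cite: HarrisKudlaSweet1996, (1.16)–(1.17), §6] [cite: Tan1999, §1–§3] [cite: Garrett2018, §3.12] -/
theorem exists_finset_reduction (hdV0 : ∀ i, dV i ≠ 0) (hdW0 : ∀ i, dW i ≠ 0) (𝒦 : IwasawaDatum L e dV hdV dW hdW)
    [MeasurableSpace (unipDelta L e dV hdV dW hdW)] [BorelSpace (unipDelta L e dV hdV dW hdW)]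
    (νN : Measure (unipDelta L e dV hdV dW hdW)) [νN.IsHaarMeasure] {χ : HeckeCharacter L} (hχ : χ.IsUnitary)
    {f : ℂ → HA L e dV hdV dW hdW → ℂ} (hf : ∀ s : ℂ, IsSiegelDeltaSection L e dV hdV dW hdW χ s (f s))
    (hflat : ∀ k ∈ (𝒦.K : Set (HA L e dV hdV dW hdW)), ∀ s s' : ℂ, f s k = f s' k) (s₀ : ℂ) (hfin : IsKFinite 𝒦 (f s₀))
    (hcont : ∀ s, Continuous (f s)) (a : ℂ → ℂ) :
    ∃ T : Finset ↥𝒦.K, ∀ Eκ : ↥𝒦.K → ℂ → ℂ,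
      (∀ κ ∈ T, DifferentiableOn ℂ (Eκ κ) {s : ℂ | 0 < s.re}) →
      (∀ κ ∈ T, ∀ s : ℂ, (n : ℝ) / 2 < s.re → Eκ κ s = a s * intertwiningDelta L e dV hdV dW hdW νN (f s) (κ : HA L e dV hdV dW hdW)) →
      ∃ E : ℂ → HA L e dV hdV dW hdW → ℂ,
        (∀ x : HA L e dV hdV dW hdW, DifferentiableOn ℂ (fun s : ℂ => E s x) {s : ℂ | 0 < s.re}) ∧
        (∀ (s : ℂ) (x : HA L e dV hdV dW hdW), (n : ℝ) / 2 < s.re → E s x = a s * intertwiningDelta L e dV hdV dW hdW νN (f s) x) := by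
  obtain ⟨T, d, B, -, -, hrep₀⟩ := exists_translate_repr L e dV hdV dW hdW 𝒦 hfin (hcont s₀)
  have hrepf : ∀ (s : ℂ) (y : HA L e dV hdV dW hdW), ∀ k ∈ (𝒦.K : Set (HA L e dV hdV dW hdW)),
      f s (y * k) = ∑ κ ∈ T, d κ k * f s (y * (κ : HA L e dV hdV dW hdW)) := fun s y k hk =>
    translate_repr_family L e dV hdV dW hdW 𝒦 hf hflat hrep₀ s y hk
  refine ⟨T, fun Eκ hEκd hEκeq => exists_continuation_of_pointwise_K L e dV hdV dW hdW hdV0 hdW0 𝒦 νN χ ((n : ℝ) / 2) f hf a fun k hk =>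
    ⟨fun s => ∑ κ ∈ T, Eκ κ s * d κ k, DifferentiableOn.fun_sum fun κ hκ => (hEκd κ hκ).mul_const (d κ k), fun s hs => ?_⟩⟩
  rw [intertwiningDelta_translate_repr L e dV hdV dW hdW hdV0 hdW0 𝒦 νN hχ hf hcont hrepf hs hk, Finset.mul_sum]
  refine Finset.sum_congr rfl fun κ hκ => ?_
  rw [hEκeq κ hκ s hs, mul_assoc]

/-! ## §4 From the socket's binders `hstd`, `hcont`; and from `h = 1` for every standard family -/

/-- **THE #41 TOP's CONTINUATION LETTER FROM FINITELY MANY SCALAR CONTINUATIONS** — socket binders `hstd : IsStandardSectionFamily 𝒦 χ f`, `hcont`, unitary `χ`: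
there is a finite `T ⊂ K` such that holomorphic continuations of `s ↦ a(s)·M(s)f_s(κ)` (`κ ∈ T`) to `{0 < re}` give `(E, hEd, hEeq)` in the TOP's bytes.
[cite: HarrisKudlaSweet1996, (1.16)–(1.17), §6] [cite: Tan1999, §1–§3] [cite: KudlaSweet1997, §1] -/
theorem exists_continuation_of_isStandardSectionFamily_finset (hdV0 : ∀ i, dV i ≠ 0) (hdW0 : ∀ i, dW i ≠ 0) (𝒦 : IwasawaDatum L e dV hdV dW hdW)
    [MeasurableSpace (unipDelta L e dV hdV dW hdW)] [BorelSpace (unipDelta L e dV hdV dW hdW)]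
    (νN : Measure (unipDelta L e dV hdV dW hdW)) [νN.IsHaarMeasure] {χ : HeckeCharacter L} (hχ : χ.IsUnitary)
    {f : ℂ → HA L e dV hdV dW hdW → ℂ} (hstd : IsStandardSectionFamily 𝒦 χ f) (hcont : ∀ s, Continuous (f s)) (a : ℂ → ℂ) :
    ∃ T : Finset ↥𝒦.K, ∀ Eκ : ↥𝒦.K → ℂ → ℂ,
      (∀ κ ∈ T, DifferentiableOn ℂ (Eκ κ) {s : ℂ | 0 < s.re}) →
      (∀ κ ∈ T, ∀ s : ℂ, (n : ℝ) / 2 < s.re → Eκ κ s = a s * intertwiningDelta L e dV hdV dW hdW νN (f s) (κ : HA L e dV hdV dW hdW)) →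
      ∃ E : ℂ → HA L e dV hdV dW hdW → ℂ,
        (∀ x : HA L e dV hdV dW hdW, DifferentiableOn ℂ (fun s : ℂ => E s x) {s : ℂ | 0 < s.re}) ∧
        (∀ (s : ℂ) (x : HA L e dV hdV dW hdW), (n : ℝ) / 2 < s.re → E s x = a s * intertwiningDelta L e dV hdV dW hdW νN (f s) x) :=
  exists_finset_reduction L e dV hdV dW hdW hdV0 hdW0 𝒦 νN hχ hstd.1.1 (fun k hk s s' => hstd.2.2 k hk s s') 0 (hstd.2.1 0) hcont a

/-- **THE #41 TOP's CONTINUATION LETTER FROM POINTWISE CONTINUATIONS ON `K`** — socket binder `hstd` only (any `χ`, any abscissa `c`): continuations of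
`s ↦ a(s)·M(s)f_s(k)` for each `k ∈ K` give `(E, hEd, hEeq)`. [cite: Garrett2018, §3.10–§3.12] [cite: MoeglinWaldspurger1995, II.1.7] -/
theorem exists_continuation_of_isStandardSectionFamily_pointwise (hdV0 : ∀ i, dV i ≠ 0) (hdW0 : ∀ i, dW i ≠ 0) (𝒦 : IwasawaDatum L e dV hdV dW hdW)
    [MeasurableSpace (unipDelta L e dV hdV dW hdW)] [BorelSpace (unipDelta L e dV hdV dW hdW)]
    (νN : Measure (unipDelta L e dV hdV dW hdW)) [νN.IsHaarMeasure] (χ : HeckeCharacter L) (c : ℝ)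
    {f : ℂ → HA L e dV hdV dW hdW → ℂ} (hstd : IsStandardSectionFamily 𝒦 χ f) (a : ℂ → ℂ)
    (hK : ∀ k ∈ (𝒦.K : Set (HA L e dV hdV dW hdW)), ∃ Ek : ℂ → ℂ, DifferentiableOn ℂ Ek {s : ℂ | 0 < s.re} ∧
      ∀ s : ℂ, c < s.re → Ek s = a s * intertwiningDelta L e dV hdV dW hdW νN (f s) k) :
    ∃ E : ℂ → HA L e dV hdV dW hdW → ℂ,
      (∀ x : HA L e dV hdV dW hdW, DifferentiableOn ℂ (fun s : ℂ => E s x) {s : ℂ | 0 < s.re}) ∧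
      (∀ (s : ℂ) (x : HA L e dV hdV dW hdW), c < s.re → E s x = a s * intertwiningDelta L e dV hdV dW hdW νN (f s) x) :=
  exists_continuation_of_pointwise_K L e dV hdV dW hdW hdV0 hdW0 𝒦 νN χ c f hstd.1.1 a hK

/-- **THE #41 TOP's CONTINUATION LETTER FROM THE VALUE AT `h = 1` OF EVERY STANDARD FAMILY** (the Euler-product point: at `h = 1` every local component lies in
`K_v`, so ★ Φ3c∕Φ3d factorise `M(s)g_s(1)` place by place).  If for every standard family `g` for `(𝒦, χ)` the scalar function `s ↦ a(s)·M(s)g_s(1)` continues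
holomorphically from `c < re s` to `{0 < re}`, then `(E, hEd, hEeq)` holds for every standard `f` — apply the hypothesis to the standard families `R_k f`, `k ∈ K`
(§1), and `M(s)(R_k f_s)(1) = M(s)f_s(k)`. [cite: Tan1999, §1–§3] [cite: KudlaSweet1997, §1] [cite: Garrett2018, §3.12] -/
theorem exists_continuation_of_atOne (hdV0 : ∀ i, dV i ≠ 0) (hdW0 : ∀ i, dW i ≠ 0) (𝒦 : IwasawaDatum L e dV hdV dW hdW)
    [MeasurableSpace (unipDelta L e dV hdV dW hdW)] [BorelSpace (unipDelta L e dV hdV dW hdW)]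
    (νN : Measure (unipDelta L e dV hdV dW hdW)) [νN.IsHaarMeasure] (χ : HeckeCharacter L) (c : ℝ) (a : ℂ → ℂ)
    (h1 : ∀ g : ℂ → HA L e dV hdV dW hdW → ℂ, IsStandardSectionFamily 𝒦 χ g → ∃ E₁ : ℂ → ℂ, DifferentiableOn ℂ E₁ {s : ℂ | 0 < s.re} ∧
      ∀ s : ℂ, c < s.re → E₁ s = a s * intertwiningDelta L e dV hdV dW hdW νN (g s) 1)
    {f : ℂ → HA L e dV hdV dW hdW → ℂ} (hstd : IsStandardSectionFamily 𝒦 χ f) :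
    ∃ E : ℂ → HA L e dV hdV dW hdW → ℂ,
      (∀ x : HA L e dV hdV dW hdW, DifferentiableOn ℂ (fun s : ℂ => E s x) {s : ℂ | 0 < s.re}) ∧
      (∀ (s : ℂ) (x : HA L e dV hdV dW hdW), c < s.re → E s x = a s * intertwiningDelta L e dV hdV dW hdW νN (f s) x) := by
  refine exists_continuation_of_pointwise_K L e dV hdV dW hdW hdV0 hdW0 𝒦 νN χ c f hstd.1.1 a fun k hk => ?_
  obtain ⟨E₁, hE₁d, hE₁eq⟩ := h1 (fun s y => f s (y * k)) (isStandardSectionFamily_rightTranslate hstd hk)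
  exact ⟨E₁, hE₁d, fun s hs => by rw [hE₁eq s hs, intertwiningDelta_rightTranslate_one]⟩

end Summit.HodgeConjecture.HodgeConjecture.Cruxes.HLiu418.K2LiuBigCellContinuationReduction

end
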